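import Summits.AtomisticToContinuum.Crystallization.Theorems.PalmUnimodularRigidityMinimiserShellsOfSepPeriodicShellGap
import Summits.AtomisticToContinuum.Crystallization.Theorems.PalmUnimodularRigidityMinimiserShellsNecessitySandwich

/-!
# The residual of crux `MinimiserShells` (stmt-AtomisticToContinuum-9225): DEFINITIONS

Route `PalmUnimodularRigidity`, crux decl
`Summit.AtomisticToContinuum.Crystallization.Theses.PalmUnimodularRigidity.MinimiserShells`, line
`equilibrium-in-law-surgery` (leads `…-0`, `…-c1-0`, …, `…-c6-0`).

The line is built modulo ONE registered stub, S7⁗ `stub_sepPeriodicShellGap` (the `1/3`-hard-core periodic shell gap).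
Two landed theorems pin the crux between that stub and its `θ`-loosenings:

* `OfSepPeriodicShellGap.minimiserShells_of_sepPeriodicShellGap` : S7⁗ → `MinimiserShells` (p121752);
* `NecessitySandwich.stub_necessity_sandwich` : `MinimiserShells` → (S7⁗ with the bad-shell test loosened by `θ`), for
  every `θ ∈ (0, 1/10]` (p123347).

This file introduces ONE predicate `ShellGap θ` (a statement-valued function of the loosening parameter `θ : ℝ`, to be
instantiated — in the spirit of `HasPeriodicGroundStateEnergy V d` / `IsCrystallizing V d` of
`Literature/MathematicalPhysics/StatisticalMechanics/Crystallization.lean`: a predicate, not a named fact awaiting a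
proof) together with the auxiliary vocabulary it is built from, so that the sandwich reads
`ShellGap 0 → MinimiserShells → ∀ θ ∈ (0, 1/10], ShellGap θ` (`Residual.lean`) and the line's residual has a stable name a
planner can point at.  `ShellGap 0` is, verbatim up to these names, the registered stub S7⁗; mathematically it is bulk
energetic crystallization of three-dimensional Lennard-Jones in periodic first-shell form on the uniformly discrete class —
an OPEN PROBLEM (Blanc–Lewin 2015, §2.3; Flatley–Theil 2015 need a three-body term for the analogous finite statement).
Nothing here is claimed to be a published fact; these are objects the route posits (D-0016 `…Defs.lean`).

* `LooseGoodShell θ μ` — the crux's good-shell predicate `GoodShell μ` with matching tolerance `a/100 + θ` and shell radius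
  `(5/4 − θ)·a`; `LooseGoodShell 0 μ ↔ GoodShell μ` (`looseGoodShell_zero_iff`).
* `rerooted Q x` — the counting measure of `Q.points − x` (the configuration of a periodic `Q` seen from `x`).
* `looseBadMotifCount θ Q` — the number of motif sites of `Q` whose shell is `θ`-loosely bad; at `θ = 0` the number of
  badly-shelled motif sites (`looseBadMotifCount_zero`).
* `IsSepThird Q` — `Q.points` is `1/3`-separated.
* `ShellGap θ` — `∀ t > 0, ∃ κ > 0, ∀ Q` periodic with `IsSepThird Q`,
  `t·#motif ≤ looseBadMotifCount θ Q → e* + κ ≤ e_LJ(Q)`.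

Read-back theorems (all by unfolding plus the landed files): `shellGap_zero_iff_stub` (`ShellGap 0` ↔ S7⁗ verbatim),
`shellGap_iff_loose` (`ShellGap θ` ↔ the inlined loosened statement of the necessity sandwich),
`shellGap_zero_iff_periodicShellGap` (↔ S7‴: the hard core costs nothing), `shellGap_zero_iff_qualShellNoBoundary` and
`shellGap_zero_iff_qualShellGapWith` (↔ the finite forms: "`𝓔_N(y_N)/N → e*` forces the bad-shell fraction to `0`"),
and the SANDWICH against the name: `minimiserShells_of_shellGap_zero : ShellGap 0 → MinimiserShells`,
`shellGap_of_minimiserShells : MinimiserShells → ∀ θ ∈ (0, 1/10], ShellGap θ`, `minimiserShells_sandwich`.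
-/

noncomputable section

open MeasureTheory
open scoped ENNReal BigOperators Classical

namespace Summit.AtomisticToContinuum.Crystallization.Theorems.PalmUnimodularRigidityMinimiserShells.Residual

open Literature.MathematicalPhysics.StatisticalMechanics (lennardJones interactionEnergy PeriodicConfiguration)
open Summit.AtomisticToContinuum.Crystallization.Theses.PalmUnimodularRigidity (MinimiserShells)
open Literature.Geometry.DiscreteGeometry (ShellCloseTo fccKissingPattern hcpKissingPattern)
open Summit.AtomisticToContinuum.Crystallization.Theorems.MinimiserShells.Negative.LoadBearing (eStar GoodShell)

/-- **Loosened good shell.**  The crux's conclusion for one rooted configuration `μ` with the matching tolerance loosened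
to `a/100 + θ` and the shell radius shrunk to `(5/4 − θ)·a`: some scale `a ∈ [9/10, 1]` at which the atoms `w ≠ 0` of `μ`
with `‖w‖ ≤ (5/4 − θ)·a` are `(a/100 + θ)`-matched, after a linear isometry, to the `a`-scaled FCC or HCP kissing pattern
(the inlined predicate of `NecessitySandwich.stub_necessity_sandwich`).  At `θ = 0` this is `GoodShell μ`. -/
def LooseGoodShell (θ : ℝ) (μ : Measure (EuclideanSpace ℝ (Fin 3))) : Prop :=
  ∃ a : ℝ, 9 / 10 ≤ a ∧ a ≤ 1 ∧ ∃ T : Finset (EuclideanSpace ℝ (Fin 3)),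
    (↑T : Set (EuclideanSpace ℝ (Fin 3))) =
        {w : EuclideanSpace ℝ (Fin 3) | μ {w} ≠ 0 ∧ w ≠ 0 ∧ ‖w‖ ≤ (5 / 4 - θ) * a} ∧
    (ShellCloseTo (a / 100 + θ) T (Finset.image (fun v : EuclideanSpace ℝ (Fin 3) => a • v) fccKissingPattern) ∨
      ShellCloseTo (a / 100 + θ) T (Finset.image (fun v : EuclideanSpace ℝ (Fin 3) => a • v) hcpKissingPattern))

/-- At `θ = 0` the loosened predicate is the crux's `GoodShell`. -/
theorem looseGoodShell_zero_iff (μ : Measure (EuclideanSpace ℝ (Fin 3))) : LooseGoodShell 0 μ ↔ GoodShell μ := by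
  simp only [LooseGoodShell, GoodShell, sub_zero, add_zero]

/-- The configuration of a periodic `Q` seen from the point `x`: the counting measure of `Q.points − x`. -/
def rerooted (Q : PeriodicConfiguration 3) (x : EuclideanSpace ℝ (Fin 3)) : Measure (EuclideanSpace ℝ (Fin 3)) :=
  (Measure.count : Measure (EuclideanSpace ℝ (Fin 3))).restrict ((fun z => z - x) '' Q.points)

/-- Number of motif sites of `Q` whose first shell, read in `Q.points` re-rooted at the site, is `θ`-loosely bad (fails even
the loosened test `LooseGoodShell θ`).  At `θ = 0`: the number of badly-shelled motif sites. -/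
def looseBadMotifCount (θ : ℝ) (Q : PeriodicConfiguration 3) : ℕ :=
  Nat.card {x : Q.motif // ¬ LooseGoodShell θ (rerooted Q (x : EuclideanSpace ℝ (Fin 3)))}

/-- At `θ = 0` the loose bad count is the bad count of the registered stub (stated with `GoodShell`). -/
theorem looseBadMotifCount_zero (Q : PeriodicConfiguration 3) :
    looseBadMotifCount 0 Q = Nat.card {x : Q.motif // ¬ GoodShell
      ((Measure.count : Measure (EuclideanSpace ℝ (Fin 3))).restrict
        ((fun z => z - (x : EuclideanSpace ℝ (Fin 3))) '' Q.points))} := by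
  unfold looseBadMotifCount rerooted
  simp only [looseGoodShell_zero_iff]

/-- `Q.points` is `1/3`-separated (the uniformly discrete class of the residual; `1/3` is the hard core of the tree's
`LennardJonesMinimalDistance_holds`). -/
def IsSepThird (Q : PeriodicConfiguration 3) : Prop :=
  ∀ p ∈ Q.points, ∀ q ∈ Q.points, p ≠ q → (1 : ℝ) / 3 ≤ dist p q

/-- **The (`θ`-loosened) hard-core periodic shell gap for Lennard-Jones in `ℝ³`** — a predicate of the loosening parameter
`θ`, to be instantiated: for every `t > 0` there is `κ > 0` such that every periodic configuration with `1/3`-separated points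
in which at least `t·#motif` motif sites are `θ`-loosely badly shelled has energy per particle `≥ e* + κ`.
`ShellGap 0` is the line's residual stub S7⁗ (`Residual.shellGap_zero_iff_stub`), which implies the crux (p121752); the crux
implies `ShellGap θ` for every `θ ∈ (0, 1/10]` (p123347).  `ShellGap 0` is OPEN: bulk energetic crystallization of
three-dimensional Lennard-Jones in periodic first-shell form (Blanc–Lewin 2015 §2.3); it is a conjecture, not a fact. -/
def ShellGap (θ : ℝ) : Prop :=
  ∀ t : ℝ, 0 < t → ∃ κ : ℝ, 0 < κ ∧ ∀ Q : PeriodicConfiguration 3, IsSepThird Q →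
    t * (Q.motif.card : ℝ) ≤ (looseBadMotifCount θ Q : ℝ) → eStar + κ ≤ Q.energyPerParticle lennardJones

/-! ## Read-back: `ShellGap` against the registered stub and the landed equivalent forms -/

/-- `ShellGap 0` is, verbatim, the registered residual stub S7⁗ `stub_sepPeriodicShellGap` of line
`equilibrium-in-law-surgery` (the hypothesis of `OfSepPeriodicShellGap.minimiserShells_of_sepPeriodicShellGap`). -/
theorem shellGap_zero_iff_stub :
    ShellGap 0 ↔
    (∀ t : ℝ, 0 < t → ∃ κ : ℝ, 0 < κ ∧ ∀ Q : PeriodicConfiguration 3,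
      (∀ p ∈ Q.points, ∀ q ∈ Q.points, p ≠ q → (1 : ℝ) / 3 ≤ dist p q) →
      t * (Q.motif.card : ℝ) ≤ (Nat.card {x : Q.motif // ¬ GoodShell
          ((Measure.count : Measure (EuclideanSpace ℝ (Fin 3))).restrict
            ((fun z => z - (x : EuclideanSpace ℝ (Fin 3))) '' Q.points))} : ℝ) →
      eStar + κ ≤ Q.energyPerParticle lennardJones) := by
  simp only [ShellGap, IsSepThird, looseBadMotifCount_zero]

/-- `ShellGap θ` is, verbatim, the inlined `θ`-loosened hard-core periodic shell gap concluded by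
`NecessitySandwich.stub_necessity_sandwich`. -/
theorem shellGap_iff_loose (θ : ℝ) :
    ShellGap θ ↔
    (∀ t : ℝ, 0 < t → ∃ κ : ℝ, 0 < κ ∧
      ∀ Q : PeriodicConfiguration 3,
        (∀ p ∈ Q.points, ∀ q ∈ Q.points, p ≠ q → (1 : ℝ) / 3 ≤ dist p q) →
        t * (Q.motif.card : ℝ) ≤ (Nat.card {x : Q.motif // ¬ (∃ a : ℝ, 9 / 10 ≤ a ∧ a ≤ 1 ∧
            ∃ T : Finset (EuclideanSpace ℝ (Fin 3)),
            (↑T : Set (EuclideanSpace ℝ (Fin 3))) = {w : EuclideanSpace ℝ (Fin 3) |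
              ((Measure.count : Measure (EuclideanSpace ℝ (Fin 3))).restrict
                ((fun z => z - (x : EuclideanSpace ℝ (Fin 3))) '' Q.points)) {w} ≠ 0 ∧ w ≠ 0 ∧ ‖w‖ ≤ (5 / 4 - θ) * a} ∧
            (ShellCloseTo (a / 100 + θ) T
              (Finset.image (fun v : EuclideanSpace ℝ (Fin 3) => a • v) fccKissingPattern) ∨
             ShellCloseTo (a / 100 + θ) T
              (Finset.image (fun v : EuclideanSpace ℝ (Fin 3) => a • v) hcpKissingPattern)))} : ℝ) →
        eStar + κ ≤ Q.energyPerParticle lennardJones) :=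
  Iff.rfl

/-- **The hard core costs nothing**: `ShellGap 0` ↔ the periodic shell gap S7‴ over ALL periodic configurations
(`OfSepPeriodicShellGap.periodicShellGap_iff_sepPeriodicShellGap`: S16 → S15e → S14 and the trivial restriction). -/
theorem shellGap_zero_iff_periodicShellGap :
    ShellGap 0 ↔
    (∀ t : ℝ, 0 < t → ∃ κ : ℝ, 0 < κ ∧ ∀ Q : PeriodicConfiguration 3,
      t * (Q.motif.card : ℝ) ≤ (Nat.card {x : Q.motif // ¬ GoodShell
          ((Measure.count : Measure (EuclideanSpace ℝ (Fin 3))).restrict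
            ((fun z => z - (x : EuclideanSpace ℝ (Fin 3))) '' Q.points))} : ℝ) →
      eStar + κ ≤ Q.energyPerParticle lennardJones) :=
  shellGap_zero_iff_stub.trans OfSepPeriodicShellGap.periodicShellGap_iff_sepPeriodicShellGap.symm

/-- **Finite no-boundary form**: `ShellGap 0` ↔ for every `t > 0` some `κ > 0` makes every finite injective configuration
with at least `t·N` badly-shelled sites have `𝓔_N ≥ N·(e* + κ)` (`OfPeriodicShellGap.periodicShellGap_iff_qualShellNoBoundary`). -/
theorem shellGap_zero_iff_qualShellNoBoundary :
    ShellGap 0 ↔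
    (∀ t : ℝ, 0 < t → ∃ κ : ℝ, 0 < κ ∧ ∀ (N : ℕ) (y : Fin N → EuclideanSpace ℝ (Fin 3)), Function.Injective y →
      t * (N : ℝ) ≤ (Nat.card {i : Fin N // ¬ GoodShell
          ((Measure.count : Measure (EuclideanSpace ℝ (Fin 3))).restrict ((fun z => z - y i) '' Set.range y))} : ℝ) →
      (N : ℝ) * (eStar + κ) ≤ interactionEnergy lennardJones y) :=
  shellGap_zero_iff_periodicShellGap.trans OfPeriodicShellGap.periodicShellGap_iff_qualShellNoBoundary

/-- **Finite form with boundary allowance** (the classical reading "`𝓔_N(y_N)/N → e*` forces `#bad(y_N)/N → 0`"):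
`ShellGap 0` ↔ for every `t > 0` some `κ > 0`, `C₀` make every finite injective configuration with at least `t·N`
badly-shelled sites have `𝓔_N ≥ N·(e* + κ) − C₀·N^{2/3}` (`OfPeriodicShellGap.periodicShellGap_iff_qualShellGapWith`). -/
theorem shellGap_zero_iff_qualShellGapWith :
    ShellGap 0 ↔
    (∀ t : ℝ, 0 < t → ∃ κ C₀ : ℝ, 0 < κ ∧ ∀ (N : ℕ) (y : Fin N → EuclideanSpace ℝ (Fin 3)),
      Function.Injective y →
      t * (N : ℝ) ≤ (Nat.card {i : Fin N // ¬ GoodShell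
          ((Measure.count : Measure (EuclideanSpace ℝ (Fin 3))).restrict ((fun z => z - y i) '' Set.range y))} : ℝ) →
      (N : ℝ) * (eStar + κ) - C₀ * (N : ℝ) ^ (2 / 3 : ℝ) ≤ interactionEnergy lennardJones y) :=
  shellGap_zero_iff_periodicShellGap.trans OfPeriodicShellGap.periodicShellGap_iff_qualShellGapWith

/-! ## The sandwich against the name -/

/-- **`ShellGap 0 → MinimiserShells`** (sufficiency of the residual; all transfers landed, p121752). -/
theorem minimiserShells_of_shellGap_zero : ShellGap 0 → MinimiserShells :=
  fun h => OfSepPeriodicShellGap.minimiserShells_of_sepPeriodicShellGap (shellGap_zero_iff_stub.1 h)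

/-- **`MinimiserShells → ShellGap θ` for every `θ ∈ (0, 1/10]`** (necessity up to loosening, p123347). -/
theorem shellGap_of_minimiserShells (h : MinimiserShells) {θ : ℝ} (hθ : 0 < θ) (hθ' : θ ≤ 1 / 10) : ShellGap θ :=
  (shellGap_iff_loose θ).2 (NecessitySandwich.stub_necessity_sandwich h θ hθ hθ')

/-- **The crux `MinimiserShells` (stmt-AtomisticToContinuum-9225) is pinned between `ShellGap 0` and every `ShellGap θ`,
`θ ∈ (0, 1/10]`**: it IS the hard-core periodic shell gap for three-dimensional Lennard-Jones, up to the closed-tolerance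
boundary of the shell predicate. -/
theorem minimiserShells_sandwich :
    (ShellGap 0 → MinimiserShells) ∧ (MinimiserShells → ∀ θ : ℝ, 0 < θ → θ ≤ 1 / 10 → ShellGap θ) :=
  ⟨minimiserShells_of_shellGap_zero, fun h _ hθ hθ' => shellGap_of_minimiserShells h hθ hθ'⟩

end Summit.AtomisticToContinuum.Crystallization.Theorems.PalmUnimodularRigidityMinimiserShells.Residual

end
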